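import Summits.Ventures.HodgeRepro2.T5SU11JacobiPhaseMomentsAsymptotic
import Summits.Ventures.HodgeRepro2.T5SU11JacobiWeightDeriv2

/-!
# The derivatives of the Jacobi transform in the weight are asymptotically those of `2π/k`;
the variance of the phase is `∼ 1/k²`

`T5SU11JacobiWeightDerivAll` identifies `(−1)^n m̂^{(n)}_k(λ)` with the `n`-th moment of the phase, and
`T5SU11JacobiPhaseMomentsAsymptotic` gives `k^{n+1} ∫_G (log|a|)^n m_k φ_λ dν → 2π n!`. Together:

  **`k^{n+1} · (−1)^n m̂^{(n)}_k(λ) → 2π n!`**   (`tendsto_pow_mul_iteratedDeriv_jacobi_weight`)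

for every `n` and every `λ` — the derivatives of the transform in the weight are asymptotically those of
`2π/k` (`(2π/k)^{(n)} = (−1)^n 2π n!/k^{n+1}`), the derivative-by-derivative form of `m̂_k(λ) ∼ 2π/k`
(`T5SU11JacobiWeightAsymptotic`). For the probability measure `m_k φ_λ dν/m̂_k(λ)`:

  **`k² · Var_{k,λ}(log|a|) → 1`**   (`tendsto_sq_mul_variance_phase`),   `k² · (log m̂)''(k) → 1`
  (`tendsto_sq_mul_deriv2_log_jacobi_weight`, by `(log m̂)'' = Var` of `T5SU11JacobiWeightDeriv2`),

from the first two moments (`k⟨log|a|⟩ → 1`, `k²⟨(log|a|)²⟩ → 2`): the rescaled phase has asymptotically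
the variance `1` of the standard exponential law, for every `λ` (at `λ = 0` the variance is exactly
`1/(k − 2)²`, `T5SU11JacobiPhaseMoments`). Nothing is claimed about (N).

Blind lane: Mathlib + the HodgeRepro2 prefix only; no sorry; axioms ⊆ {propext, Classical.choice,
Quot.sound}.
-/

namespace Summit.Ventures.HodgeRepro2.T5SU11JacobiWeightDerivAsymptotic

open MeasureTheory MeasureTheory.Measure Metric Set Filter Topology
open T5SU11Unimodular T5SU11Fibration T5SU11Cartan T5HaarCircle T5BergmanCoefficient
  T5SU11FibrationHaar T5SU11SphericalFunction T5SU11SphericalSymmetry T5SU11SphericalBounds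
  T5SU11SphericalContinuous T5SU11JacobiIwasawa T5SU11JacobiTransform T5SU11JacobiWeight
  T5SU11KFiniteMajorantPow T5SU11JacobiWeightDeriv T5SU11JacobiWeightDeriv2
  T5SU11JacobiWeightDerivAll T5SU11JacobiPhaseMomentsAsymptotic
open scoped Real

/-- `2! = 2`, as a real number. -/
theorem factorial_two_real : ((Nat.factorial 2 : ℕ) : ℝ) = 2 := by norm_num [Nat.factorial]

section measure

variable [MeasurableSpace Circle] [BorelSpace Circle]

/-- **The derivatives in the weight are asymptotically those of `2π/k`**: for every `n` and `λ`,
`k^{n+1} · (−1)^n m̂^{(n)}_k(λ) → 2π n!` as `k → ∞`. -/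
theorem tendsto_pow_mul_iteratedDeriv_jacobi_weight (lam : ℝ) (n : ℕ) :
    Tendsto (fun k : ℝ => k ^ (n + 1) * ((-1 : ℝ) ^ n
        * iteratedDeriv n (fun k => ∫ g, (1 - ‖orbit g‖ ^ 2) ^ (k / 2) * sph lam g ∂(nu haarCircle)) k))
      atTop (𝓝 (2 * π * (n.factorial : ℝ))) := by
  refine (tendsto_pow_mul_phase_moment lam n).congr' ?_
  filter_upwards [eventually_gt_atTop (max 1 (max lam (2 - lam)))] with k hk
  rw [max_lt_iff, max_lt_iff] at hk
  rw [iteratedDeriv_jacobi_weight_eq_moment lam n hk.1 hk.2.1 (by linarith [hk.2.2])]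

/-- **`k² · Var_{k,λ}(log|a|) → 1`**: with `⟨f⟩_{k,λ} = (∫_G f m_k φ_λ dν)/m̂_k(λ)`,
`k² (⟨(log|a|)²⟩ − ⟨log|a|⟩²) → 1` as `k → ∞`, for every `λ`. -/
theorem tendsto_sq_mul_variance_phase (lam : ℝ) :
    Tendsto (fun k : ℝ => k ^ 2
        * ((∫ g, Real.log ‖mat g 0 0‖ ^ 2 * ((1 - ‖orbit g‖ ^ 2) ^ (k / 2) * sph lam g) ∂(nu haarCircle))
            / (∫ g, (1 - ‖orbit g‖ ^ 2) ^ (k / 2) * sph lam g ∂(nu haarCircle))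
          - ((∫ g, Real.log ‖mat g 0 0‖ * ((1 - ‖orbit g‖ ^ 2) ^ (k / 2) * sph lam g) ∂(nu haarCircle))
            / (∫ g, (1 - ‖orbit g‖ ^ 2) ^ (k / 2) * sph lam g ∂(nu haarCircle))) ^ 2))
      atTop (𝓝 1) := by
  have h2 := tendsto_pow_mul_normalized_phase_moment lam 2
  have h1 := tendsto_pow_mul_normalized_phase_moment lam 1
  simp only [pow_one, Nat.factorial_one, Nat.cast_one] at h1
  rw [factorial_two_real] at h2
  have h := h2.sub (h1.pow 2)
  rw [one_pow, show (2 : ℝ) - 1 = 1 by norm_num] at h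
  refine h.congr' (Filter.Eventually.of_forall fun k => ?_)
  simp only
  ring

/-- **`k² · (log m̂)''(k) → 1`** as `k → ∞`, for every `λ` (`(log m̂)'' = Var`). -/
theorem tendsto_sq_mul_deriv2_log_jacobi_weight (lam : ℝ) :
    Tendsto (fun k : ℝ => k ^ 2
        * deriv (deriv fun k => Real.log (∫ g, (1 - ‖orbit g‖ ^ 2) ^ (k / 2) * sph lam g ∂(nu haarCircle))) k)
      atTop (𝓝 1) := by
  refine (tendsto_sq_mul_variance_phase lam).congr' ?_
  filter_upwards [eventually_gt_atTop (max 1 (max lam (2 - lam)))] with k hk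
  rw [max_lt_iff, max_lt_iff] at hk
  rw [deriv2_log_jacobi_weight hk.1 hk.2.1 (by linarith [hk.2.2])]

end measure

end Summit.Ventures.HodgeRepro2.T5SU11JacobiWeightDerivAsymptotic
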